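import Literature.NumberTheory.EllipticCurves.BDPAnticyclotomicPAdicLFunction
import Literature.NumberTheory.GaloisRepresentations.AbsGaloisOuterConj
import Literature.NumberTheory.GaloisRepresentations.CMTypeHeckeCharacter
import Literature.NumberTheory.GaloisRepresentations.HeckeCharacterRamificationProofs
import Literature.NumberTheory.GaloisRepresentations.FrobeniusDivisionDensityProofs
import HarnessLib

/-!
# X11b @ `p = 3`, S24-a (λ-supply), part (C): TRANSPORT of `p`-adic avatars along the outer
# action of `Γ_F` on `Γ_K` — the avatar of `χ ∘ τ̄` is `r ∘ θ_τ`; rigidity; the quadratic case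

HONEST FRAMING (cell `b2b-bsdres`, run/shared/lean/b2b/bsd-rank1-residual/, verbatim in every
file): the goal of the cell is to DELETE the COMBINATION-SHAPED residual classes of the
Birch–Swinnerton-Dyer formula for ALL analytic-rank `≤ 1` elliptic curves over `ℚ` — assembled
STRICTLY from published theorems — so that the rank-`≤ 1` remainder becomes exactly the
CONSTRUCTION-SHAPED classes, which are TYPED, NOT attempted. This is not "finishing BSD". Team N8/O2
(X11b at `3`: `3 ‖ N`, `r_an = 1`, `E[3]` irreducible): research route; nothing booked; NO label
changes; O2 stays OPEN. THEOREMS ONLY (Galois bookkeeping over PROVED tree infrastructure); no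
definition, no fact, no `sorry`.

PROVENANCE: sub-target S24 'λ-SUPPLY SPLIT' (OWNERS R7-59 / R7-66, lead x11b3 GEN 6; owner seat
`b2b-bsdres-x11b3-p7`), part **(C) "Transport"** of p7's feasibility census
(`HOME/b2b-bsdres-x11b3-p7/s24/S24-FEASIBILITY.md` §2 (C)), taken as second hand by seat
`b2b-bsdres-x11b3-p2` (gen. 4; OWNERS offer row 2026-08-21T10:22Z). Sibling of part (E)
`X11b/Three/LambdaSupplyRankTwo.lean` (p260777), whose `θ`-currency
(`hθ : ∀ σ, res (θ σ) = c · res σ · c⁻¹`) and `hanti : g (θ σ) = (g σ)⁻¹` this file serves.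

WHAT THE CENSUS CALLED MISSING IS IN THE TREE: the Galois half of (C) — conjugation of primes of
`\bar ℤ_K`, inertia groups and arithmetic Frobenii by an element of `Γ_F ∖ Γ_K` — is
`Literature/NumberTheory/GaloisRepresentations/AbsGaloisOuterConj.lean` (all proved):
`absGaloisOuterConj F K τ = θ_τ` (`res (θ_τ σ) = τ · res σ · τ⁻¹`), `absGaloisQuot F K : Γ_F → Gal(K/F)`,
`FramedGaloisRep.outerConj τ r = r ∘ θ_τ`, `isUnramifiedAt_outerConj_iff`,
`hasFrobCharpolyAt_outerConj_iff` (w.r.t. the action `τ̄ • w` on places of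
`Automorphic/GaloisActionPlaces`, the SAME action as the Hecke side
`HeckeCharacter.isUnramifiedAt_galConj_iff` / `valueAtUniformizer_galConj_of_isUnramifiedAt` of
`CMTypeHeckeCharacter` §1). This file is the ≈ 40-line glue, its quadratic specialisation and the
rigidity of avatars; the rank-one currency lemmas the assembly (F) consumes are the sequel
`LambdaSupplyQuotient.lean`.

## What this file proves (`K/F` Galois number fields — for S24: `F = ℚ`, `K` imaginary quadratic;
## every prime `p`; `ι : ℚ̄_p ≃ ℂ`)

* §1 `isPAdicAvatarOf_galConj_outerConj` (**TRANSPORT**): `IsPAdicAvatarOf ι χ r →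
  IsPAdicAvatarOf ι (χ ∘ τ̄) (r ∘ θ_τ)` for every `τ ∈ Γ_F`; `θ`-abstract form
  `isPAdicAvatarOf_galConj_comp` under (E)'s `hθ` (`eq_absGaloisOuterConj_of_res_eq`: such a `θ` IS
  `θ_c`).
* §2 quadratic `K`: `absGaloisQuot_eq_of_not_mem_range` — for `c ∈ Γ_ℚ ∖ res(Γ_K)`, `c̄` is THE
  non-trivial automorphism of `K` (so `χ ∘ c̄` is `galConj σ χ` for any `σ ≠ 1`);
  `isPAdicAvatarOf_galConj_comp_of_finrank_eq_two`; CM currency (that of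
  `HeckeCharacter.HasInfinityType.galConj_complexConj`, `IsCMField.complexConj K : K ≃ₐ[K⁺] K`):
  `galConj_restrictScalars` (change of base field for `galConj` is `rfl`),
  `absGaloisQuot_eq_restrictScalars_complexConj`, `isPAdicAvatarOf_galConj_complexConj_comp`.
* §3 `eq_of_isPAdicAvatarOf` (**RIGIDITY**): two avatars of one Hecke character are EQUAL
  (Frobenius density `absoluteGaloisGroup.subgroup_eq_top_of_isClosed_of_frobenius_mem` on the
  closed equaliser; exceptional set = places above `p` ∪ ramified places of `χ`, finite by
  `HeckeCharacter.finite_ramifiedPlaces_holds`).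
* §4–§5 (rank-one currency `e ∘ ψ`, products / inverses, the quotient `ψ · (ψ ∘ θ)⁻¹`, its
  anti-invariance and that of EVERY avatar of `χ · (χ ∘ c̄)⁻¹`) are the sequel file
  `X11b/Three/LambdaSupplyQuotient.lean`.

## References

* J.-P. Serre, *Abelian ℓ-adic representations and elliptic curves* (1968), Ch. I §2.1–2.3
  (unramified places, Frobenius, Chebotarev uniqueness), Ch. II §2.7. [SerreAbelianLadic1968]
* J. Neukirch, *Algebraic Number Theory* (1999), Ch. I §9 ((9.1)–(9.5): conjugate primes,
  decomposition / inertia groups and Frobenius under `τ`). [NeukirchANT1999]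
* R. Greenberg, *Non-vanishing of certain values of `L`-functions*, Progr. Math. 70 (1987), §2
  (complex conjugation acting on characters of `Gal(K̃_∞/K)`; anticyclotomic = anti-invariant).
  [Greenberg1987]
* F. Castella, M.-L. Hsieh, *Heegner cycles and `p`-adic `L`-functions*, Math. Ann. 370 (2018), §3.3
  (the `p`-adic avatar `φ̂` as a Galois character). [CastellaHsieh2018]
-/

noncomputable section

open scoped NumberField Polynomial
open NumberField IsDedekindDomain Field Polynomial
  Literature.NumberTheory.GaloisRepresentations Literature.NumberTheory.EllipticCurves
  Literature.NumberTheory.Automorphic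

namespace Summit.BirchSwinnertonDyer.Rank1Residual.X11b.Three.LambdaSupply

/-! ### §1. Transport of `IsPAdicAvatarOf` along `(galConj τ̄, outerConj τ)` -/

section Transport

variable {F K : Type} [Field F] [Field K] [NumberField K] [Algebra F K]
  {p : ℕ} [Fact p.Prime]

omit [NumberField K] in
/-- A rational integer lies in the conjugate prime `σ • v` iff it lies in `v` (`σ` fixes `n`).
[folklore] -/
theorem natCast_mem_smul_asIdeal_iff (σ : K ≃ₐ[F] K) (v : HeightOneSpectrum (𝓞 K)) (n : ℕ) :
    ((n : ℕ) : 𝓞 K) ∈ (σ • v).asIdeal ↔ ((n : ℕ) : 𝓞 K) ∈ v.asIdeal := by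
  have h : σ • ((n : ℕ) : 𝓞 K) = (n : 𝓞 K) :=
    map_natCast (MulSemiringAction.toRingHom (K ≃ₐ[F] K) (𝓞 K) σ) n
  rw [HeightOneSpectrum.smul_asIdeal]
  conv_lhs => rw [← h]
  exact Ideal.smul_mem_pointwise_smul_iff

variable [IsGalois F K]

/-- **Transport of avatars.** If `r` is the `p`-adic avatar of the Hecke character `χ` of `K`
(`IsPAdicAvatarOf ι χ r`), then for every `τ ∈ Γ_F` the conjugate representation
`r^τ = r ∘ θ_τ` (`FramedGaloisRep.outerConj`) is the avatar of the conjugate character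
`χ ∘ τ̄` (`HeckeCharacter.galConj (absGaloisQuot F K τ) χ`). [folklore] -/
theorem isPAdicAvatarOf_galConj_outerConj (ι : PadicAlgCl p ≃+* ℂ) {χ : HeckeCharacter K}
    {r : FramedGaloisRep K (PadicAlgCl p) 1} (h : IsPAdicAvatarOf ι χ r)
    (τ : absoluteGaloisGroup F) :
    IsPAdicAvatarOf ι (HeckeCharacter.galConj (absGaloisQuot F K τ) χ) (r.outerConj τ) := by
  intro v hpv hunr
  set σ := absGaloisQuot F K τ with hσ
  have hunr' : χ.IsUnramifiedAt (σ • v) :=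
    (HeckeCharacter.isUnramifiedAt_galConj_iff σ χ v).1 hunr
  have hpv' : ((p : ℕ) : 𝓞 K) ∉ (σ • v).asIdeal := fun hm =>
    hpv ((natCast_mem_smul_asIdeal_iff σ v p).1 hm)
  obtain ⟨h1, h2⟩ := h (σ • v) hpv' hunr'
  refine ⟨(FramedGaloisRep.isUnramifiedAt_outerConj_iff τ r v).2 h1, ?_⟩
  rw [HeckeCharacter.valueAtUniformizer_galConj_of_isUnramifiedAt σ χ v hunr']
  exact (FramedGaloisRep.hasFrobCharpolyAt_outerConj_iff τ r v _).2 h2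

/-- The lift `θ` of conjugation by `c ∈ Γ_F` characterised by `res (θ σ) = c · res σ · c⁻¹`
IS the outer action `absGaloisOuterConj F K c` (`res` injective). [folklore] -/
theorem eq_absGaloisOuterConj_of_res_eq {c : absoluteGaloisGroup F}
    {θ : absoluteGaloisGroup K →ₜ* absoluteGaloisGroup K}
    (hθ : ∀ σ, absGaloisRestrict F K (θ σ) = c * absGaloisRestrict F K σ * c⁻¹) :
    θ = absGaloisOuterConj F K c := by
  refine ContinuousMonoidHom.ext fun σ => absGaloisRestrict_injective F K ?_
  rw [hθ, absGaloisRestrict_absGaloisOuterConj]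

/-- **Transport of avatars, `θ`-abstract form** (the currency of part (E),
`LambdaSupply.apply_eq_one_of_anti`): for any continuous `θ : Γ_K → Γ_K` with
`res (θ σ) = c · res σ · c⁻¹`, the avatar of `χ ∘ c̄` is `r ∘ θ`. [folklore] -/
theorem isPAdicAvatarOf_galConj_comp (ι : PadicAlgCl p ≃+* ℂ) {χ : HeckeCharacter K}
    {r : FramedGaloisRep K (PadicAlgCl p) 1} (h : IsPAdicAvatarOf ι χ r)
    {c : absoluteGaloisGroup F} {θ : absoluteGaloisGroup K →ₜ* absoluteGaloisGroup K}
    (hθ : ∀ σ, absGaloisRestrict F K (θ σ) = c * absGaloisRestrict F K σ * c⁻¹) :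
    IsPAdicAvatarOf ι (HeckeCharacter.galConj (absGaloisQuot F K c) χ) (r.comp θ) := by
  rw [eq_absGaloisOuterConj_of_res_eq hθ]
  exact isPAdicAvatarOf_galConj_outerConj ι h c

end Transport

/-! ### §2. The quadratic case: `τ̄` is THE non-trivial automorphism -/

section Quadratic

variable {K : Type} [Field K] [NumberField K] [IsGalois ℚ K] {p : ℕ} [Fact p.Prime]

/-- In a quadratic field any two non-trivial automorphisms coincide. [folklore] -/
theorem algEquiv_eq_of_ne_one_of_finrank_eq_two (hK : Module.finrank ℚ K = 2)
    {σ σ' : K ≃ₐ[ℚ] K} (hσ : σ ≠ 1) (hσ' : σ' ≠ 1) : σ = σ' := by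
  classical
  by_contra hne
  have hcard : Nat.card (K ≃ₐ[ℚ] K) = 2 := by rw [IsGalois.card_aut_eq_finrank, hK]
  haveI : Fintype (K ≃ₐ[ℚ] K) := Fintype.ofFinite _
  have hlt : 2 < Fintype.card (K ≃ₐ[ℚ] K) := by
    rw [← Finset.card_univ]
    exact Finset.two_lt_card_iff.mpr ⟨1, σ, σ', Finset.mem_univ _, Finset.mem_univ _,
      Finset.mem_univ _, hσ.symm, hσ'.symm, hne⟩
  rw [Nat.card_eq_fintype_card] at hcard
  omega

/-- **For `K` quadratic and `c ∈ Γ_ℚ ∖ res(Γ_K)`, `c̄ = absGaloisQuot ℚ K c` is the non-trivial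
automorphism of `K`** (any prescribed `σ ≠ 1`, e.g. complex conjugation for `K` imaginary).
[folklore] -/
theorem absGaloisQuot_eq_of_not_mem_range (hK : Module.finrank ℚ K = 2)
    {c : absoluteGaloisGroup ℚ} (hc : c ∉ Set.range (absGaloisRestrict ℚ K))
    {σ : K ≃ₐ[ℚ] K} (hσ : σ ≠ 1) : absGaloisQuot ℚ K c = σ := by
  refine algEquiv_eq_of_ne_one_of_finrank_eq_two hK (fun h1 => hc ?_) hσ
  obtain ⟨x, hx⟩ := (absGaloisQuot_eq_one_iff ℚ K c).1 h1
  exact ⟨x, hx⟩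

/-- **Transport, quadratic form**: `K` quadratic, `c ∈ Γ_ℚ ∖ res(Γ_K)`, `θ` the lift of
conjugation by `c`, `σ ≠ 1` the non-trivial automorphism of `K`; then the avatar of `χ ∘ σ` is
`r ∘ θ`. [folklore] -/
theorem isPAdicAvatarOf_galConj_comp_of_finrank_eq_two (hK : Module.finrank ℚ K = 2)
    (ι : PadicAlgCl p ≃+* ℂ) {χ : HeckeCharacter K} {r : FramedGaloisRep K (PadicAlgCl p) 1}
    (h : IsPAdicAvatarOf ι χ r) {c : absoluteGaloisGroup ℚ}
    (hc : c ∉ Set.range (absGaloisRestrict ℚ K))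
    {θ : absoluteGaloisGroup K →ₜ* absoluteGaloisGroup K}
    (hθ : ∀ σ, absGaloisRestrict ℚ K (θ σ) = c * absGaloisRestrict ℚ K σ * c⁻¹)
    {σ : K ≃ₐ[ℚ] K} (hσ : σ ≠ 1) :
    IsPAdicAvatarOf ι (HeckeCharacter.galConj σ χ) (r.comp θ) := by
  rw [← absGaloisQuot_eq_of_not_mem_range hK hc hσ]
  exact isPAdicAvatarOf_galConj_comp ι h hθ

/-- **Change of base for `galConj` is definitional**: conjugating by `σ : K ≃ₐ[F₁] K` or by its
restriction of scalars `σ.restrictScalars F₀ : K ≃ₐ[F₀] K` is the same Hecke character (both act on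
the ideles through the underlying ring automorphism). Used with `F₁ = K⁺`, `F₀ = ℚ` for the complex
conjugation `IsCMField.complexConj K : K ≃ₐ[K⁺] K` of a CM field. [folklore] -/
theorem galConj_restrictScalars {F₀ F₁ K : Type} [Field F₀] [Field F₁] [Field K] [NumberField K]
    [Algebra F₀ K] [Algebra F₁ K] [Algebra F₀ F₁] [IsScalarTower F₀ F₁ K] (σ : K ≃ₐ[F₁] K)
    (χ : HeckeCharacter K) :
    HeckeCharacter.galConj (σ.restrictScalars F₀) χ = HeckeCharacter.galConj σ χ :=
  rfl

/-- The complex conjugation of a CM field, restricted to a `ℚ`-automorphism, is not the identity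
(Mathlib `IsCMField.complexConj_ne_one`). [folklore] -/
theorem restrictScalars_complexConj_ne_one {K : Type} [Field K] [NumberField K] [IsCMField K] :
    ((IsCMField.complexConj K).restrictScalars ℚ : K ≃ₐ[ℚ] K) ≠ 1 := fun h =>
  IsCMField.complexConj_ne_one K (AlgEquiv.ext fun x => AlgEquiv.congr_fun h x)

/-- **For an imaginary quadratic (CM, `[K : ℚ] = 2`) field and `c ∈ Γ_ℚ ∖ res(Γ_K)`: `c̄` IS complex
conjugation** (as a `ℚ`-automorphism). [folklore] -/
theorem absGaloisQuot_eq_restrictScalars_complexConj [IsCMField K] (hK : Module.finrank ℚ K = 2)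
    {c : absoluteGaloisGroup ℚ} (hc : c ∉ Set.range (absGaloisRestrict ℚ K)) :
    absGaloisQuot ℚ K c = (IsCMField.complexConj K).restrictScalars ℚ :=
  absGaloisQuot_eq_of_not_mem_range hK hc restrictScalars_complexConj_ne_one

/-- **Transport, CM form** — the currency of `HeckeCharacter.HasInfinityType.galConj_complexConj`:
`K` imaginary quadratic CM field, `c ∈ Γ_ℚ ∖ res(Γ_K)`, `θ` the lift of conjugation by `c`; the
avatar of `χ ∘ (complex conjugation)` is `r ∘ θ`. [folklore] -/
theorem isPAdicAvatarOf_galConj_complexConj_comp [IsCMField K] (hK : Module.finrank ℚ K = 2)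
    (ι : PadicAlgCl p ≃+* ℂ) {χ : HeckeCharacter K} {r : FramedGaloisRep K (PadicAlgCl p) 1}
    (h : IsPAdicAvatarOf ι χ r) {c : absoluteGaloisGroup ℚ}
    (hc : c ∉ Set.range (absGaloisRestrict ℚ K))
    {θ : absoluteGaloisGroup K →ₜ* absoluteGaloisGroup K}
    (hθ : ∀ σ, absGaloisRestrict ℚ K (θ σ) = c * absGaloisRestrict ℚ K σ * c⁻¹) :
    IsPAdicAvatarOf ι (HeckeCharacter.galConj (IsCMField.complexConj K) χ) (r.comp θ) := by
  rw [← galConj_restrictScalars (F₀ := ℚ), ← absGaloisQuot_eq_restrictScalars_complexConj hK hc]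
  exact isPAdicAvatarOf_galConj_comp ι h hθ

end Quadratic

/-! ### §3. Rank-one rigidity: the avatar is unique -/

section Unique

variable {K : Type} [Field K] [NumberField K] {p : ℕ} [Fact p.Prime]

/-- **Rigidity of avatars.** Two `p`-adic avatars of the same Hecke character are EQUAL: they
agree on every arithmetic Frobenius above every place `v ∤ p` at which `χ` is unramified (both
have Frobenius polynomial `X - ι⁻¹(χ(ϖ_v))⁻¹` there), these places are all but finitely many
(`HeckeCharacter.finite_ramifiedPlaces_holds`), and a closed subgroup of `Γ_K` containing all
these Frobenii is `Γ_K` (`absoluteGaloisGroup.subgroup_eq_top_of_isClosed_of_frobenius_mem`,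
Frobenius density). [folklore] -/
theorem eq_of_isPAdicAvatarOf (ι : PadicAlgCl p ≃+* ℂ) {χ : HeckeCharacter K}
    {r r' : FramedGaloisRep K (PadicAlgCl p) 1} (h : IsPAdicAvatarOf ι χ r)
    (h' : IsPAdicAvatarOf ι χ r') : r' = r := by
  classical
  -- the exceptional set: places above `p` and ramified places of `χ`
  set S : Set (HeightOneSpectrum (𝓞 K)) :=
    {v | ((p : ℕ) : 𝓞 K) ∈ v.asIdeal} ∪ {v | ¬ χ.IsUnramifiedAt v} with hS
  have hp0 : ((p : ℕ) : 𝓞 K) ≠ 0 := Nat.cast_ne_zero.2 (Fact.out : p.Prime).ne_zero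
  have hSfin : S.Finite :=
    (HeckeCharacter.finite_setOf_mem_asIdeal hp0).union χ.finite_ramifiedPlaces_holds
  -- the equaliser of `r` and `r'`, a closed subgroup
  let H : Subgroup (absoluteGaloisGroup K) := MonoidHom.eqLocus r'.toMonoidHom r.toMonoidHom
  have hHc : IsClosed (H : Set (absoluteGaloisGroup K)) :=
    isClosed_eq r'.continuous r.continuous
  have hH : H = ⊤ := by
    refine Literature.NumberTheory.GaloisRepresentations.absoluteGaloisGroup.subgroup_eq_top_of_isClosed_of_frobenius_mem
      hSfin hHc ?_
    intro v hv 𝔓 h𝔓 Φ hΦ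
    simp only [hS, Set.mem_union, Set.mem_setOf_eq, not_or, not_not] at hv
    have e := (FramedGaloisRep.hasFrobCharpolyAt_iff_of_rank_one r v _).1 (h v hv.1 hv.2).2 𝔓 h𝔓 Φ hΦ
    have e' := (FramedGaloisRep.hasFrobCharpolyAt_iff_of_rank_one r' v _).1 (h' v hv.1 hv.2).2 𝔓 h𝔓 Φ hΦ
    -- a `1 × 1` matrix is its `(0,0)` entry (cf. `Literature.NumberTheory.Automorphic.GL_fin_one_ext`,
    -- not imported to keep the automorphic closure out of this file)
    exact Matrix.GeneralLinearGroup.ext fun i j => by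
      rw [Subsingleton.elim i 0, Subsingleton.elim j 0]; exact e'.trans e.symm
  refine ContinuousMonoidHom.ext fun σ => ?_
  have hσ : σ ∈ H := by rw [hH]; exact Subgroup.mem_top σ
  exact hσ

end Unique

end Summit.BirchSwinnertonDyer.Rank1Residual.X11b.Three.LambdaSupply

end
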